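import Mathlib
import HarnessLib
import Summits.Ventures.LatticeQCDFlow.Scoring.KishESSCLT
import Summits.Ventures.LatticeQCDFlow.Scoring.SelfNormalisedReweightingStudentisedCLT

/-!
# An ERROR BAR for the printed ESS column, I: the plug-in standard error
# `√n (Kₙ − 1/M₂)/ŝₙ ⇒ N(0, 1)` with the plug-in standard error
# `ŝₙ² = (1/n) Σᵢ (2Kₙŵᵢ − Kₙ²ŵᵢ² − Kₙ)²`, `ŵᵢ = w̃ᵢ/W̄ₙ` the self-normalised weights

HONEST FRAMING: exact (Metropolis-corrected) sampling algorithms for lattice gauge theory;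
figures of merit are autocorrelation/cost numbers at stated couplings and volumes; no
continuum-physics claim.

Venture `LatticeQCDFlow` (cell pub-lqcd), topic `Scoring`; FANOUT row 4 (`s0-u1-b`, rung S0-B).
Sequel of `Scoring/KishESSCLT` (imported: `√n (Kₙ − 1/M₂) ⇒ Y/M₂²`, `Y ∼ N(0, σ²_K)`,
`σ²_K = E_q(2M₂w − w² − M₂)²`).  The asymptotic variance `σ²_K/M₂⁴` is a polynomial in the
weight moments `E_q wᵏ`, `k ≤ 4`, and in `1/M₂`; everything printed is in unnormalised weights
`w̃ = c·w` (`c` unknown), but the SELF-NORMALISED weights `ŵᵢ = w̃ᵢ/W̄ₙ = wᵢ/W̄ₙʷ` and the Kish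
fraction `Kₙ` (an estimate of `1/M₂`) are scale-free, so
`ŝₙ² = (1/n) Σᵢ (2Kₙŵᵢ − Kₙ²ŵᵢ² − Kₙ)²` is computable from the card.  Expanding the square,
`ŝₙ²` is an explicit rational function of `Kₙ`, `W̄ₙʷ` and the empirical moments
`m_k = (1/n)Σᵢ wᵢᵏ`, `k = 1, …, 4`, all strongly consistent (row 4's strong law along the stream,
`Scoring/SelfNormalisedReweightingConsistency`), whence `ŝₙ² → σ²_K/M₂⁴` almost surely; Slutsky
and the eventual-agreement device of `Scoring/SelfNormalisedReweightingStudentisedCLT` give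
`√n (Kₙ − 1/M₂)/ŝₙ ⇒ N(0, 1)`: the interval `Kₙ ± z·ŝₙ/√n` has asymptotically exact coverage
for the population ESS fraction `1/M₂`.  Printed counterparts NAMED ONLY (nothing cited as a
fact): the delta method with plug-in variance (van der Vaart 1998 §3.1); Kong–Liu–Wong (1994).
NEW WORK of the cell; no definition is introduced.

## Content (`ν = μ.withDensity q`, `w = p/q`, `M₂ = ∫ p²/q dμ`, `ξ = 2M₂w − w² − M₂`)

§1 `sum_sq_kishPlugin_expand` (the square expanded over a block), `integral_sq_kishScore_expand`
(`∫ ξ² dν` in weight moments), `kishPlugin_limit_eq` (the two expansions agree at the limit);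
§2 `normalisedWeight_scale_free`, **`kishStdErr_tendsto_ae`** (`ŝₙ² → σ²_K/M₂⁴` a.s.);
§3 **`kishFrac_studentised_clt`** — THE THEOREM (`σ²_K > 0`; moments `p²/q, p³/q², p⁴/q³`).

NOT CLAIMED: the degenerate case `σ²_K = 0`; finite-sample calibration; any number of ours
re-scored.
-/

noncomputable section

namespace Summit.Ventures.LatticeQCDFlow.Scoring.CardConsistency

open MeasureTheory ProbabilityTheory Finset Real Filter
open scoped Topology Function

/-! ## §1 Expansions -/

section Expand

/-- **The plug-in square expanded over a block**:
`Σ_{i<n}(2k(wᵢ/v) − k²(wᵢ/v)² − k)² = (4k²/v²)Σwᵢ² + (k⁴/v⁴)Σwᵢ⁴ + n·k² + (−4k³/v³)Σwᵢ³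
+ (−4k²/v)Σwᵢ + (2k³/v²)Σwᵢ²`. [ours] -/
theorem sum_sq_kishPlugin_expand (k v : ℝ) (w : ℕ → ℝ) (n : ℕ) :
    ∑ i ∈ range n, (2 * k * (w i / v) - k ^ 2 * (w i / v) ^ 2 - k) ^ 2
      = 4 * k ^ 2 / v ^ 2 * ∑ i ∈ range n, w i ^ 2 + k ^ 4 / v ^ 4 * ∑ i ∈ range n, w i ^ 4
        + n * k ^ 2 + -4 * k ^ 3 / v ^ 3 * ∑ i ∈ range n, w i ^ 3
        + -4 * k ^ 2 / v * ∑ i ∈ range n, w i + 2 * k ^ 3 / v ^ 2 * ∑ i ∈ range n, w i ^ 2 := by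
  have e : ∀ i, (2 * k * (w i / v) - k ^ 2 * (w i / v) ^ 2 - k) ^ 2
      = 4 * k ^ 2 / v ^ 2 * w i ^ 2 + k ^ 4 / v ^ 4 * w i ^ 4 + k ^ 2
        + -4 * k ^ 3 / v ^ 3 * w i ^ 3 + -4 * k ^ 2 / v * w i + 2 * k ^ 3 / v ^ 2 * w i ^ 2 := by
    intro i
    ring
  simp only [e, sum_add_distrib, ← mul_sum, sum_const, card_range, nsmul_eq_mul]

variable {X : Type*} [MeasurableSpace X] {μ : Measure X} {p q : X → ℝ}

/-- `wᵏ ∈ L¹(q dμ) ↔ pᵏ/q^{k−1} ∈ L¹(μ)` instances: `w`, `w²`, `w³`, `w⁴` are ν-integrable under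
the stated moment hypotheses. [ours] -/
theorem integrable_weightPow_model (hpm : Measurable p) (hpi : Integrable p μ)
    (hq0 : ∀ z, 0 < q z) (hqm : Measurable q) (hM2i : Integrable (fun z => p z ^ 2 / q z) μ)
    (hM3i : Integrable (fun z => p z ^ 3 / q z ^ 2) μ)
    (hM4i : Integrable (fun z => p z ^ 4 / q z ^ 3) μ) :
    Integrable (fun a => p a / q a) (μ.withDensity fun z => ENNReal.ofReal (q z))
      ∧ Integrable (fun a => (p a / q a) ^ 2) (μ.withDensity fun z => ENNReal.ofReal (q z))
      ∧ Integrable (fun a => (p a / q a) ^ 3) (μ.withDensity fun z => ENNReal.ofReal (q z))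
      ∧ Integrable (fun a => (p a / q a) ^ 4) (μ.withDensity fun z => ENNReal.ofReal (q z)) := by
  have _ := hpm
  refine ⟨(AllPairsVariance.integral_weight_withDensity_eq (μ := μ) hpi hq0 hqm).1, ?_, ?_, ?_⟩
  · rw [AllPairsVariance.integrable_withDensity_iff' (fun z => (hq0 z).le) hqm]
    have h : (fun a => (p a / q a) ^ 2 * q a) = fun a => p a ^ 2 / q a := by
      funext a
      field_simp [(hq0 a).ne']
    rw [h]
    exact hM2i
  · rw [AllPairsVariance.integrable_withDensity_iff' (fun z => (hq0 z).le) hqm]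
    have h : (fun a => (p a / q a) ^ 3 * q a) = fun a => p a ^ 3 / q a ^ 2 := by
      funext a
      field_simp [(hq0 a).ne']
    rw [h]
    exact hM3i
  · rw [AllPairsVariance.integrable_withDensity_iff' (fun z => (hq0 z).le) hqm]
    have h : (fun a => (p a / q a) ^ 4 * q a) = fun a => p a ^ 4 / q a ^ 3 := by
      funext a
      field_simp [(hq0 a).ne']
    rw [h]
    exact hM4i

/-- **`∫ ξ² dν` in weight moments**: with `M = ∫ p²/q dμ` and a normalised target,
`∫ (2Mw − w² − M)² dν = 4M²·∫w² + ∫w⁴ + M² + (−4M)∫w³ + (−4M²)·1 + 2M·∫w²`. [ours] -/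
theorem integral_sq_kishScore_expand
    (hν : IsProbabilityMeasure (μ.withDensity fun z => ENNReal.ofReal (q z)))
    (hpm : Measurable p) (hpi : Integrable p μ) (hp1 : ∫ z, p z ∂μ = 1) (hq0 : ∀ z, 0 < q z)
    (hqm : Measurable q) (hM2i : Integrable (fun z => p z ^ 2 / q z) μ)
    (hM3i : Integrable (fun z => p z ^ 3 / q z ^ 2) μ)
    (hM4i : Integrable (fun z => p z ^ 4 / q z ^ 3) μ) (M : ℝ) :
    ∫ a, (2 * M * (p a / q a) - (p a / q a) ^ 2 - M) ^ 2
        ∂(μ.withDensity fun z => ENNReal.ofReal (q z))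
      = 4 * M ^ 2 * (∫ a, (p a / q a) ^ 2 ∂(μ.withDensity fun z => ENNReal.ofReal (q z)))
        + (∫ a, (p a / q a) ^ 4 ∂(μ.withDensity fun z => ENNReal.ofReal (q z)))
        + M ^ 2 + -4 * M * (∫ a, (p a / q a) ^ 3 ∂(μ.withDensity fun z => ENNReal.ofReal (q z)))
        + -4 * M ^ 2
        + 2 * M * (∫ a, (p a / q a) ^ 2 ∂(μ.withDensity fun z => ENNReal.ofReal (q z))) := by
  obtain ⟨h1, h2, h3, h4⟩ := integrable_weightPow_model hpm hpi hq0 hqm hM2i hM3i hM4i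
  have hw1 : ∫ a, p a / q a ∂(μ.withDensity fun z => ENNReal.ofReal (q z)) = 1 := by
    rw [(AllPairsVariance.integral_weight_withDensity_eq (μ := μ) hpi hq0 hqm).2, hp1]
  have e : (fun a => (2 * M * (p a / q a) - (p a / q a) ^ 2 - M) ^ 2)
      = fun a => 4 * M ^ 2 * (p a / q a) ^ 2 + (p a / q a) ^ 4 + M ^ 2
        + -4 * M * (p a / q a) ^ 3 + -4 * M ^ 2 * (p a / q a) + 2 * M * (p a / q a) ^ 2 := by
    funext a
    ring
  have i1 : Integrable (fun a => 4 * M ^ 2 * (p a / q a) ^ 2)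
      (μ.withDensity fun z => ENNReal.ofReal (q z)) := h2.const_mul _
  have i12 : Integrable (fun a => 4 * M ^ 2 * (p a / q a) ^ 2 + (p a / q a) ^ 4)
      (μ.withDensity fun z => ENNReal.ofReal (q z)) := i1.add h4
  have i123 : Integrable (fun a => 4 * M ^ 2 * (p a / q a) ^ 2 + (p a / q a) ^ 4 + M ^ 2)
      (μ.withDensity fun z => ENNReal.ofReal (q z)) := i12.add (integrable_const _)
  have i4 : Integrable (fun a => -4 * M * (p a / q a) ^ 3)
      (μ.withDensity fun z => ENNReal.ofReal (q z)) := h3.const_mul _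
  have i1234 : Integrable (fun a => 4 * M ^ 2 * (p a / q a) ^ 2 + (p a / q a) ^ 4 + M ^ 2
      + -4 * M * (p a / q a) ^ 3) (μ.withDensity fun z => ENNReal.ofReal (q z)) := i123.add i4
  have i5 : Integrable (fun a => -4 * M ^ 2 * (p a / q a))
      (μ.withDensity fun z => ENNReal.ofReal (q z)) := h1.const_mul _
  have i12345 : Integrable (fun a => 4 * M ^ 2 * (p a / q a) ^ 2 + (p a / q a) ^ 4 + M ^ 2
      + -4 * M * (p a / q a) ^ 3 + -4 * M ^ 2 * (p a / q a))
      (μ.withDensity fun z => ENNReal.ofReal (q z)) := i1234.add i5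
  have i6 : Integrable (fun a => 2 * M * (p a / q a) ^ 2)
      (μ.withDensity fun z => ENNReal.ofReal (q z)) := h2.const_mul _
  rw [e, integral_add i12345 i6, integral_add i1234 i5, integral_add i123 i4,
    integral_add i12 (integrable_const _), integral_add i1 h4, integral_const_mul,
    integral_const_mul, integral_const_mul, integral_const_mul, hw1, integral_const, smul_eq_mul,
    probReal_univ]
  ring

/-- **The two expansions agree at the limit**: at `k = 1/M`, `v = 1` the plug-in coefficients
reproduce `(∫ ξ² dν)/M⁴` (pure algebra, `M ≠ 0`). [ours] -/
theorem kishPlugin_limit_eq {M I₂ I₃ I₄ : ℝ} (hM : M ≠ 0) :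
    4 * M⁻¹ ^ 2 / (1 : ℝ) ^ 2 * I₂ + M⁻¹ ^ 4 / (1 : ℝ) ^ 4 * I₄ + M⁻¹ ^ 2
        + -4 * M⁻¹ ^ 3 / (1 : ℝ) ^ 3 * I₃ + -4 * M⁻¹ ^ 2 / 1 * 1 + 2 * M⁻¹ ^ 3 / (1 : ℝ) ^ 2 * I₂
      = (4 * M ^ 2 * I₂ + I₄ + M ^ 2 + -4 * M * I₃ + -4 * M ^ 2 + 2 * M * I₂) / M ^ 4 := by
  field_simp

end Expand

/-! ## §2 The plug-in standard error is strongly consistent -/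

section StdErr

variable {Ω : Type*} [MeasurableSpace Ω] {P : Measure Ω} [IsProbabilityMeasure P]
variable {X : Type*} [MeasurableSpace X] {μ : Measure X} {p q : X → ℝ} {y : ℕ → Ω → X}

omit [MeasurableSpace Ω] [IsProbabilityMeasure P] [MeasurableSpace X] in
/-- **Self-normalised weights are scale-free**: `w̃ᵢ/(Σ_{j<n} w̃ⱼ/n) = wᵢ/(Σ_{j<n} wⱼ/n)` for
`w̃ = c·w`, `c ≠ 0`. [ours] -/
theorem normalisedWeight_scale_free {wt : X → ℝ} {c : ℝ} (hc : c ≠ 0)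
    (hwt : ∀ z, wt z = c * (p z / q z)) (v : ℕ → X) (n i : ℕ) :
    wt (v i) / ((∑ j ∈ range n, wt (v j)) / n)
      = (p (v i) / q (v i)) / ((∑ j ∈ range n, p (v j) / q (v j)) / n) := by
  have e : ∑ j ∈ range n, wt (v j) = c * ∑ j ∈ range n, p (v j) / q (v j) := by
    rw [mul_sum]
    exact sum_congr rfl fun j _ => hwt _
  have e' : c * (∑ j ∈ range n, p (v j) / q (v j)) / (n : ℝ)
      = c * ((∑ j ∈ range n, p (v j) / q (v j)) / (n : ℝ)) := by ring
  rw [hwt, e, e', mul_div_mul_left _ _ hc]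

/-- **THE PLUG-IN STANDARD ERROR OF THE ESS COLUMN IS STRONGLY CONSISTENT.**  With
`Kₙ = kishESS/n` the printed Kish fraction and `ŵᵢ = w̃ᵢ/W̄ₙ` the self-normalised weights (any
`c ≠ 0`), almost surely
`ŝₙ² = (1/n) Σ_{i<n} (2Kₙŵᵢ − Kₙ²ŵᵢ² − Kₙ)² → (∫ (2M₂w − w² − M₂)² dν)/M₂⁴`, the asymptotic
variance of `√n (Kₙ − 1/M₂)`; moments `p²/q, p³/q², p⁴/q³ ∈ L¹(μ)`. [ours] -/
theorem kishStdErr_tendsto_ae (hym : ∀ j, Measurable (y j)) (hind : iIndepFun y P)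
    (hlaw : ∀ j, Measure.map (y j) P = μ.withDensity fun z => ENNReal.ofReal (q z))
    (hpm : Measurable p) (hpi : Integrable p μ) (hp1 : ∫ z, p z ∂μ = 1) (hq0 : ∀ z, 0 < q z)
    (hqm : Measurable q) (hM2i : Integrable (fun z => p z ^ 2 / q z) μ)
    (hM3i : Integrable (fun z => p z ^ 3 / q z ^ 2) μ)
    (hM4i : Integrable (fun z => p z ^ 4 / q z ^ 3) μ) {wt : X → ℝ} {c : ℝ} (hc : c ≠ 0)
    (hwt : ∀ z, wt z = c * (p z / q z)) :
    ∀ᵐ ω ∂P, Tendsto (fun n : ℕ => (∑ i ∈ range n,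
        (2 * (kishESS (range n) (fun j => wt (y j ω)) / (n : ℝ))
            * (wt (y i ω) / ((∑ j ∈ range n, wt (y j ω)) / (n : ℝ)))
          - (kishESS (range n) (fun j => wt (y j ω)) / (n : ℝ)) ^ 2
            * (wt (y i ω) / ((∑ j ∈ range n, wt (y j ω)) / (n : ℝ))) ^ 2
          - kishESS (range n) (fun j => wt (y j ω)) / (n : ℝ)) ^ 2) / (n : ℝ)) atTop
      (𝓝 ((∫ a, (2 * (∫ z, p z ^ 2 / q z ∂μ) * (p a / q a) - (p a / q a) ^ 2
        - ∫ z, p z ^ 2 / q z ∂μ) ^ 2 ∂(μ.withDensity fun z => ENNReal.ofReal (q z)))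
        / (∫ z, p z ^ 2 / q z ∂μ) ^ 4)) := by
  haveI hν : IsProbabilityMeasure (μ.withDensity fun z => ENNReal.ofReal (q z)) :=
    hlaw 0 ▸ Measure.isProbabilityMeasure_map (hym 0).aemeasurable
  obtain ⟨h1, h2, h3, h4⟩ := integrable_weightPow_model hpm hpi hq0 hqm hM2i hM3i hM4i
  have hM0 : (∫ z, p z ^ 2 / q z ∂μ) ≠ 0 :=
    (one_pos.trans_le (KishESSMedian.one_le_secondMoment_model hν hpm hpi hp1 hq0 hqm hM2i)).ne'
  have hwm : Measurable fun a => p a / q a := hpm.div hqm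
  -- the empirical moments along the stream
  have hm1 := strong_law_stream hym hind hlaw (g := fun a => p a / q a) hwm h1
  have hm2 := strong_law_stream hym hind hlaw (g := fun a => (p a / q a) ^ 2) (hwm.pow_const 2) h2
  have hm3 := strong_law_stream hym hind hlaw (g := fun a => (p a / q a) ^ 3) (hwm.pow_const 3) h3
  have hm4 := strong_law_stream hym hind hlaw (g := fun a => (p a / q a) ^ 4) (hwm.pow_const 4) h4
  rw [(AllPairsVariance.integral_weight_withDensity_eq (μ := μ) hpi hq0 hqm).2, hp1] at hm1
  have hK := kishFrac_tendsto_ae hym hind hlaw hpm hpi hp1 hq0 hqm hM2i hc hwt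
  filter_upwards [hm1, hm2, hm3, hm4, hK] with ω hm1 hm2 hm3 hm4 hK
  -- the printed plug-in, expanded
  have hexp : ∀ n : ℕ, (∑ i ∈ range n,
      (2 * (kishESS (range n) (fun j => wt (y j ω)) / (n : ℝ))
          * (wt (y i ω) / ((∑ j ∈ range n, wt (y j ω)) / (n : ℝ)))
        - (kishESS (range n) (fun j => wt (y j ω)) / (n : ℝ)) ^ 2
          * (wt (y i ω) / ((∑ j ∈ range n, wt (y j ω)) / (n : ℝ))) ^ 2
        - kishESS (range n) (fun j => wt (y j ω)) / (n : ℝ)) ^ 2) / (n : ℝ)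
      = (4 * (kishESS (range n) (fun j => wt (y j ω)) / (n : ℝ)) ^ 2
            / ((∑ j ∈ range n, p (y j ω) / q (y j ω)) / (n : ℝ)) ^ 2
            * ∑ i ∈ range n, (p (y i ω) / q (y i ω)) ^ 2
          + (kishESS (range n) (fun j => wt (y j ω)) / (n : ℝ)) ^ 4
            / ((∑ j ∈ range n, p (y j ω) / q (y j ω)) / (n : ℝ)) ^ 4
            * ∑ i ∈ range n, (p (y i ω) / q (y i ω)) ^ 4
          + (n : ℝ) * (kishESS (range n) (fun j => wt (y j ω)) / (n : ℝ)) ^ 2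
          + -4 * (kishESS (range n) (fun j => wt (y j ω)) / (n : ℝ)) ^ 3
            / ((∑ j ∈ range n, p (y j ω) / q (y j ω)) / (n : ℝ)) ^ 3
            * ∑ i ∈ range n, (p (y i ω) / q (y i ω)) ^ 3
          + -4 * (kishESS (range n) (fun j => wt (y j ω)) / (n : ℝ)) ^ 2
            / ((∑ j ∈ range n, p (y j ω) / q (y j ω)) / (n : ℝ))
            * ∑ i ∈ range n, p (y i ω) / q (y i ω)
          + 2 * (kishESS (range n) (fun j => wt (y j ω)) / (n : ℝ)) ^ 3
            / ((∑ j ∈ range n, p (y j ω) / q (y j ω)) / (n : ℝ)) ^ 2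
            * ∑ i ∈ range n, (p (y i ω) / q (y i ω)) ^ 2) / (n : ℝ) := by
    intro n
    simp only [normalisedWeight_scale_free hc hwt (fun i => y i ω) n]
    rw [sum_sq_kishPlugin_expand]
  simp only [hexp]
  -- the limit, term by term
  have hW1 : Tendsto (fun n : ℕ => (∑ j ∈ range n, p (y j ω) / q (y j ω)) / (n : ℝ)) atTop (𝓝 1) :=
    hm1
  have key : Tendsto (fun n : ℕ =>
      (4 * (kishESS (range n) (fun j => wt (y j ω)) / (n : ℝ)) ^ 2
            / ((∑ j ∈ range n, p (y j ω) / q (y j ω)) / (n : ℝ)) ^ 2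
            * ∑ i ∈ range n, (p (y i ω) / q (y i ω)) ^ 2
          + (kishESS (range n) (fun j => wt (y j ω)) / (n : ℝ)) ^ 4
            / ((∑ j ∈ range n, p (y j ω) / q (y j ω)) / (n : ℝ)) ^ 4
            * ∑ i ∈ range n, (p (y i ω) / q (y i ω)) ^ 4
          + (n : ℝ) * (kishESS (range n) (fun j => wt (y j ω)) / (n : ℝ)) ^ 2
          + -4 * (kishESS (range n) (fun j => wt (y j ω)) / (n : ℝ)) ^ 3
            / ((∑ j ∈ range n, p (y j ω) / q (y j ω)) / (n : ℝ)) ^ 3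
            * ∑ i ∈ range n, (p (y i ω) / q (y i ω)) ^ 3
          + -4 * (kishESS (range n) (fun j => wt (y j ω)) / (n : ℝ)) ^ 2
            / ((∑ j ∈ range n, p (y j ω) / q (y j ω)) / (n : ℝ))
            * ∑ i ∈ range n, p (y i ω) / q (y i ω)
          + 2 * (kishESS (range n) (fun j => wt (y j ω)) / (n : ℝ)) ^ 3
            / ((∑ j ∈ range n, p (y j ω) / q (y j ω)) / (n : ℝ)) ^ 2
            * ∑ i ∈ range n, (p (y i ω) / q (y i ω)) ^ 2) / (n : ℝ)) atTop
      (𝓝 (4 * (∫ z, p z ^ 2 / q z ∂μ)⁻¹ ^ 2 / (1 : ℝ) ^ 2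
          * (∫ a, (p a / q a) ^ 2 ∂(μ.withDensity fun z => ENNReal.ofReal (q z)))
        + (∫ z, p z ^ 2 / q z ∂μ)⁻¹ ^ 4 / (1 : ℝ) ^ 4
          * (∫ a, (p a / q a) ^ 4 ∂(μ.withDensity fun z => ENNReal.ofReal (q z)))
        + (∫ z, p z ^ 2 / q z ∂μ)⁻¹ ^ 2
        + -4 * (∫ z, p z ^ 2 / q z ∂μ)⁻¹ ^ 3 / (1 : ℝ) ^ 3
          * (∫ a, (p a / q a) ^ 3 ∂(μ.withDensity fun z => ENNReal.ofReal (q z)))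
        + -4 * (∫ z, p z ^ 2 / q z ∂μ)⁻¹ ^ 2 / 1 * 1
        + 2 * (∫ z, p z ^ 2 / q z ∂μ)⁻¹ ^ 3 / (1 : ℝ) ^ 2
          * (∫ a, (p a / q a) ^ 2 ∂(μ.withDensity fun z => ENNReal.ofReal (q z))))) := by
    -- distribute the final `/n` onto the moment sums: `(C·Σ)/n = C·(Σ/n)`, `(n K²)/n = K²`
    have hsplit : ∀ᶠ n : ℕ in atTop,
        (4 * (kishESS (range n) (fun j => wt (y j ω)) / (n : ℝ)) ^ 2
              / ((∑ j ∈ range n, p (y j ω) / q (y j ω)) / (n : ℝ)) ^ 2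
              * ((∑ i ∈ range n, (p (y i ω) / q (y i ω)) ^ 2) / (n : ℝ))
            + (kishESS (range n) (fun j => wt (y j ω)) / (n : ℝ)) ^ 4
              / ((∑ j ∈ range n, p (y j ω) / q (y j ω)) / (n : ℝ)) ^ 4
              * ((∑ i ∈ range n, (p (y i ω) / q (y i ω)) ^ 4) / (n : ℝ))
            + (kishESS (range n) (fun j => wt (y j ω)) / (n : ℝ)) ^ 2
            + -4 * (kishESS (range n) (fun j => wt (y j ω)) / (n : ℝ)) ^ 3
              / ((∑ j ∈ range n, p (y j ω) / q (y j ω)) / (n : ℝ)) ^ 3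
              * ((∑ i ∈ range n, (p (y i ω) / q (y i ω)) ^ 3) / (n : ℝ))
            + -4 * (kishESS (range n) (fun j => wt (y j ω)) / (n : ℝ)) ^ 2
              / ((∑ j ∈ range n, p (y j ω) / q (y j ω)) / (n : ℝ))
              * ((∑ i ∈ range n, p (y i ω) / q (y i ω)) / (n : ℝ))
            + 2 * (kishESS (range n) (fun j => wt (y j ω)) / (n : ℝ)) ^ 3
              / ((∑ j ∈ range n, p (y j ω) / q (y j ω)) / (n : ℝ)) ^ 2
              * ((∑ i ∈ range n, (p (y i ω) / q (y i ω)) ^ 2) / (n : ℝ)))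
          = (4 * (kishESS (range n) (fun j => wt (y j ω)) / (n : ℝ)) ^ 2
              / ((∑ j ∈ range n, p (y j ω) / q (y j ω)) / (n : ℝ)) ^ 2
              * ∑ i ∈ range n, (p (y i ω) / q (y i ω)) ^ 2
            + (kishESS (range n) (fun j => wt (y j ω)) / (n : ℝ)) ^ 4
              / ((∑ j ∈ range n, p (y j ω) / q (y j ω)) / (n : ℝ)) ^ 4
              * ∑ i ∈ range n, (p (y i ω) / q (y i ω)) ^ 4
            + (n : ℝ) * (kishESS (range n) (fun j => wt (y j ω)) / (n : ℝ)) ^ 2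
            + -4 * (kishESS (range n) (fun j => wt (y j ω)) / (n : ℝ)) ^ 3
              / ((∑ j ∈ range n, p (y j ω) / q (y j ω)) / (n : ℝ)) ^ 3
              * ∑ i ∈ range n, (p (y i ω) / q (y i ω)) ^ 3
            + -4 * (kishESS (range n) (fun j => wt (y j ω)) / (n : ℝ)) ^ 2
              / ((∑ j ∈ range n, p (y j ω) / q (y j ω)) / (n : ℝ))
              * ∑ i ∈ range n, p (y i ω) / q (y i ω)
            + 2 * (kishESS (range n) (fun j => wt (y j ω)) / (n : ℝ)) ^ 3
              / ((∑ j ∈ range n, p (y j ω) / q (y j ω)) / (n : ℝ)) ^ 2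
              * ∑ i ∈ range n, (p (y i ω) / q (y i ω)) ^ 2) / (n : ℝ) := by
      filter_upwards [eventually_ge_atTop 1] with n hn
      have hn0 : (n : ℝ) ≠ 0 := by positivity
      field_simp
    refine Tendsto.congr' hsplit ?_
    refine ((((((((hK.pow 2).const_mul 4).div (hW1.pow 2) (by norm_num)).mul hm2).add
      ((((hK.pow 4).div (hW1.pow 4) (by norm_num)).mul hm4))).add (hK.pow 2)).add
      ((((hK.pow 3).const_mul (-4)).div (hW1.pow 3) (by norm_num)).mul hm3)).add
      ((((hK.pow 2).const_mul (-4)).div hW1 (by norm_num)).mul hm1)).add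
      ((((hK.pow 3).const_mul 2).div (hW1.pow 2) (by norm_num)).mul hm2)
  rw [kishPlugin_limit_eq hM0, ← integral_sq_kishScore_expand hν hpm hpi hp1 hq0 hqm hM2i hM3i
    hM4i] at key
  exact key

end StdErr

end Summit.Ventures.LatticeQCDFlow.Scoring.CardConsistency

end
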